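import Literature.Algebra.Homology.GroupCohomologyResolutionComparison
import Literature.Algebra.Homology.GroupCohomologyFiniteTypeResolution
import Literature.Algebra.Homology.GroupCohomologyFiniteIndexModuleFinite
import Literature.Algebra.Homology.ShapiroNaturality
import Literature.Algebra.Homology.FiniteIndexCohomologySummand
import HarnessLib

/-!
# Groups whose cohomology is of finite type: finitely generated values and commutation with
# directed unions, and their behaviour under commensurability

Topic `Algebra/Homology`; namespace `Literature.Algebra.Homology`.  Definitions with bodies (one
`Type`-valued structure of data with two operations, one `Prop`-valued structure) and theorems; no
named fact, no instance, no `sorry`.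

For a group `G` and a commutative ring `k`, the two consequences of "`G` is of type `FP_∞` over
`k`" that the integral comparison arguments of [Scholze2015, §V.4] actually use are

* (**F**) `Hⁿ(G, A)` is a finitely generated `k`-module for `A` finitely generated (`k`
  Noetherian) [Brown1982CohomologyGroups, VIII.4 Ex. 1], [Serre1971CohomologieGroupesDiscrets,
  §1.8 Remarque];
* (**U**) `Hⁿ(G, -)` commutes with directed unions: for a directed family of subrepresentations
  `A_i ↪ B` exhausting `B` (`DirectedSubrepSystem`), every class of `Hⁿ(G, B)` comes from some
  `Hⁿ(G, A_i)`, and a class of `Hⁿ(G, A_i)` dying in `Hⁿ(G, B)` dies in some `Hⁿ(G, A_j)`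
  [Brown1982CohomologyGroups, VIII (4.6), (4.8)].

`IsCohFiniteTypeUpTo k G m` records (F) and the two halves of (U) UP TO THE MULTIPLIER `m : ℕ`
(the preimage maps to `m • x`; `m • y` dies), the form in which (U) ascends along a subgroup of
finite index `m` without a transfer map: the unit `η : A → Coind_S^G Res A` and the trace `τ` with
`η ≫ τ = [G : S] • 𝟙` (`FiniteIndexCohomologySummand`) and the natural Shapiro isomorphism
(`ShapiroNaturality`) [Brown1982CohomologyGroups, III (6.2), Prop. 9.5].  Results:

* `isCohFiniteTypeUpTo_one_of_projectiveResolution` — type `FP_∞` (a projective resolution of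
  `k` by finitely generated free `k[G]`-modules) implies the property with `m = 1`
  (`GroupCohomologyFiniteTypeResolution`, `GroupCohomologyResolutionComparison`);
* `IsCohFiniteTypeUpTo.mul_right` (weakening the multiplier), `.of_mulEquiv` (transport along a
  group isomorphism, Mathlib `groupCohomology.resNatTrans` / `mapIso`), `.subgroup` (descent to a
  subgroup of finite index, Shapiro), `.of_subgroup` (ascent from a subgroup of finite index `d`,
  multiplier `m * d`), `.of_commensurable` (commensurable subgroups of a common group).

These feed the stabilisers `Γ_x = GL₂(K) ∩ x U x⁻¹` (commensurable with `GL₂(𝓞_K)`) of the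
integral structures of the completed-cohomology continuity argument from a finiteness witness for
the single group `GL₂(𝓞_K)`.

## References

* K. S. Brown, *Cohomology of Groups*, GTM 87 (1982), III (6.2), III Prop. 9.5, VIII (4.6),
  (4.8), VIII (5.1). [Brown1982CohomologyGroups]
* J.-P. Serre, *Cohomologie des groupes discrets*, Ann. of Math. Studies 70 (1971), §1.8.
  [Serre1971CohomologieGroupesDiscrets]
* P. Scholze, Ann. of Math. 182 (2015), §V.4, proof of Thm. V.4.1. [Scholze2015]
-/

noncomputable section

open CategoryTheory groupCohomology

universe u

namespace Literature.Algebra.Homology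

/-! ### Small element-form helpers for `groupCohomology.map` -/

section Helpers

variable {k G : Type u} [CommRing k] [Group G]

/-- `Hⁿ(φ ≫ ψ) x = Hⁿ(ψ) (Hⁿ(φ) x)`. [folklore] -/
theorem map_id_comp_apply {A B C : Rep.{u} k G} (φ : A ⟶ B) (ψ : B ⟶ C) (n : ℕ)
    (x : groupCohomology A n) :
    groupCohomology.map (MonoidHom.id G) (φ ≫ ψ) n x =
      groupCohomology.map (MonoidHom.id G) ψ n (groupCohomology.map (MonoidHom.id G) φ n x) := by
  rw [groupCohomology.map_id_comp]
  rfl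

/-- `e.hom (e.inv x) = x` for an isomorphism of `k`-modules. [folklore] -/
theorem iso_hom_inv_apply {M N : ModuleCat.{u} k} (e : M ≅ N) (x : N) : e.hom (e.inv x) = x := by
  change (e.inv ≫ e.hom) x = x
  rw [e.inv_hom_id]
  rfl

/-- `e.inv (e.hom x) = x` for an isomorphism of `k`-modules. [folklore] -/
theorem iso_inv_hom_apply {M N : ModuleCat.{u} k} (e : M ≅ N) (x : M) : e.inv (e.hom x) = x := by
  change (e.hom ≫ e.inv) x = x
  rw [e.hom_inv_id]
  rfl

/-- `coindMap` of a composite. [folklore] -/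
theorem coindMap_comp (S : Subgroup G) {X Y Z : Rep.{u} k S} (ψ₁ : X ⟶ Y) (ψ₂ : Y ⟶ Z) :
    Rep.coindMap S.subtype (ψ₁ ≫ ψ₂) = Rep.coindMap S.subtype ψ₁ ≫ Rep.coindMap S.subtype ψ₂ :=
  (Rep.coindFunctor k S.subtype).map_comp ψ₁ ψ₂

/-- `coindMap` of an injective morphism is injective. [folklore] -/
theorem coindMap_injective (S : Subgroup G) {X Y : Rep.{u} k S} (ψ : X ⟶ Y)
    (hψ : Function.Injective ψ.hom) : Function.Injective (Rep.coindMap S.subtype ψ).hom := by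
  intro f g hfg
  apply Subtype.ext
  funext x
  apply hψ
  have h := congrArg (fun F : Rep.coind S.subtype Y => (F : G → Y) x) hfg
  simpa [Rep.coindMap] using h

/-- Element form of the inverse Shapiro naturality. [cite: Brown1982CohomologyGroups, III (6.2)] -/
theorem coindIso_inv_naturality_apply (S : Subgroup G) {A B : Rep.{u} k S} (φ : A ⟶ B) (n : ℕ)
    (x : groupCohomology A n) :
    (groupCohomology.coindIso B n).inv (groupCohomology.map (MonoidHom.id S) φ n x) =
      groupCohomology.map (MonoidHom.id G) (Rep.coindMap S.subtype φ) n
        ((groupCohomology.coindIso A n).inv x) := by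
  change (groupCohomology.map (MonoidHom.id S) φ n ≫ (groupCohomology.coindIso B n).inv) x =
    ((groupCohomology.coindIso A n).inv ≫
      groupCohomology.map (MonoidHom.id G) (Rep.coindMap S.subtype φ) n) x
  rw [coindIso_inv_naturality]

end Helpers

/-! ### Directed systems of subrepresentations -/

/-- **A directed family of subrepresentations exhausting a representation**: injective morphisms
`φ i : A i ⟶ B` of `k`-linear representations of `G` indexed by a non-empty directed preorder,
compatible transition maps `t : A i ⟶ A j` (`i ≤ j`), with `B = ⋃ im φ i`.  (The shape of
directed union along which [Brown1982CohomologyGroups, VIII (4.6)] is used in [Scholze2015, §V.4]: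
the lattices `p^{-t} M ⊂ V`.) [cite: Brown1982CohomologyGroups, VIII (4.6)] -/
structure DirectedSubrepSystem (k G : Type u) [CommRing k] [Group G] where
  /-- the index preorder -/
  ι : Type u
  /-- it is a preorder -/
  [preorder : Preorder ι]
  /-- it is directed -/
  [isDirected : IsDirected ι (· ≤ ·)]
  /-- it is non-empty -/
  [nonempty : Nonempty ι]
  /-- the members -/
  A : ι → Rep.{u} k G
  /-- the union -/
  B : Rep.{u} k G
  /-- the inclusions of the members into the union -/
  φ : ∀ i, A i ⟶ B
  /-- the inclusions are injective -/
  injective : ∀ i, Function.Injective (φ i).hom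
  /-- the transition maps -/
  t : ∀ ⦃i j : ι⦄, i ≤ j → (A i ⟶ A j)
  /-- compatibility of transitions and inclusions -/
  t_comp : ∀ ⦃i j : ι⦄ (h : i ≤ j), t h ≫ φ j = φ i
  /-- the members exhaust the union -/
  exhaust : ∀ b : B, ∃ i, ∃ a : A i, (φ i).hom a = b

namespace DirectedSubrepSystem

variable {k G : Type u} [CommRing k] [Group G]

attribute [instance] DirectedSubrepSystem.preorder DirectedSubrepSystem.isDirected
  DirectedSubrepSystem.nonempty

/-- Element form of `t_comp`. [folklore] -/
theorem φ_t_apply (D : DirectedSubrepSystem k G) {i j : D.ι} (h : i ≤ j) (a : D.A i) :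
    (D.φ j).hom ((D.t h).hom a) = (D.φ i).hom a := by
  have h' := congrArg (fun f : D.A i ⟶ D.B => f.hom a) (D.t_comp h)
  simpa [Rep.hom_comp] using h'

/-- The transition maps are injective. [folklore] -/
theorem t_injective (D : DirectedSubrepSystem k G) {i j : D.ι} (h : i ≤ j) :
    Function.Injective (D.t h).hom := by
  intro a b hab
  apply D.injective i
  rw [← D.φ_t_apply h, ← D.φ_t_apply h, hab]

/-! #### Restriction along a group homomorphism -/

/-- **Restriction of a directed system along `f : H →* G`** (same modules and maps).
[folklore] -/
@[reducible]
def res {H : Type u} [Group H] (f : H →* G) (D : DirectedSubrepSystem k G) :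
    DirectedSubrepSystem k H where
  ι := D.ι
  A i := Rep.res f (D.A i)
  B := Rep.res f D.B
  φ i := (Rep.resFunctor f).map (D.φ i)
  injective i := D.injective i
  t _ _ h := (Rep.resFunctor f).map (D.t h)
  t_comp _ _ h := by rw [← Functor.map_comp, D.t_comp]
  exhaust := D.exhaust

/-! #### Coinduction from a subgroup of finite index -/

section Coind

variable (S : Subgroup G) (D : DirectedSubrepSystem k S) [S.FiniteIndex]

/-- **Exhaustion of `Coind_S^G B` by the `Coind_S^G A_i`** for `S` of finite index: an
equivariant function `G → B` takes its values on a (finite) set of coset representatives in a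
common `A_i`, hence everywhere. [cite: Brown1982CohomologyGroups, III §5] -/
theorem coind_exhaust (F : Rep.coind S.subtype D.B) :
    ∃ i, ∃ F' : Rep.coind S.subtype (D.A i), (Rep.coindMap S.subtype (D.φ i)).hom F' = F := by
  classical
  haveI : Finite (Quotient (QuotientGroup.rightRel S)) :=
    Finite.of_equiv (G ⧸ S) (QuotientGroup.quotientRightRelEquivQuotientLeftRel S).symm
  -- a common index for the values on representatives of the right cosets `S x`
  have hval : ∀ c : Quotient (QuotientGroup.rightRel S), ∃ i, ∃ a : D.A i,
      (D.φ i).hom a = (F : G → D.B) c.out := fun c => D.exhaust _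
  choose i₀ a₀ ha₀ using hval
  obtain ⟨i, hi⟩ := Finite.exists_le i₀
  -- every value of `F` lies in `im φ i`
  have hmem : ∀ x : G, ∃ a : D.A i, (D.φ i).hom a = (F : G → D.B) x := by
    intro x
    let c : Quotient (QuotientGroup.rightRel S) := Quotient.mk _ x
    have hrel : x * c.out⁻¹ ∈ S := by
      have h1 : (Quotient.mk _ c.out : Quotient (QuotientGroup.rightRel S)) = Quotient.mk _ x :=
        Quotient.out_eq c
      exact QuotientGroup.rightRel_apply.mp (Quotient.exact h1)
    let s : S := ⟨x * c.out⁻¹, hrel⟩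
    have hs : (s : G) * c.out = x := by simp [s]
    refine ⟨(D.A i).ρ s ((D.t (hi c)).hom (a₀ c)), ?_⟩
    rw [Rep.hom_comm_apply, D.φ_t_apply, ha₀ c, ← hs]
    exact (F.2 s c.out).symm
  choose a ha using hmem
  have haeq : ∀ (s : S) (x : G), a ((s : G) * x) = (D.A i).ρ s (a x) := by
    intro s x
    apply D.injective i
    rw [ha, Rep.hom_comm_apply, ha]
    exact F.2 s x
  refine ⟨i, ⟨a, (Representation.mem_coindV _ _ _).2 fun s x => haeq s x⟩, ?_⟩
  apply Subtype.ext
  funext x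
  simpa [Rep.coindMap] using ha x

/-- **Coinduction of a directed system** from a subgroup of finite index.
[cite: Brown1982CohomologyGroups, III §5] -/
@[reducible]
def coind : DirectedSubrepSystem k G where
  ι := D.ι
  A i := Rep.coind S.subtype (D.A i)
  B := Rep.coind S.subtype D.B
  φ i := Rep.coindMap S.subtype (D.φ i)
  injective i := coindMap_injective S (D.φ i) (D.injective i)
  t _ _ h := Rep.coindMap S.subtype (D.t h)
  t_comp _ _ h := by rw [← coindMap_comp, D.t_comp]
  exhaust := coind_exhaust S D

end Coind

end DirectedSubrepSystem

/-! ### The finite-type property of `Hⁿ(G, -)`, up to a multiplier -/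

/-- **`Hⁿ(G, -)` is of finite type over `k`, up to the multiplier `m`**: (F) finitely generated
values on finitely generated coefficients (`k` Noetherian), and (U) commutation with directed
unions of subrepresentations up to `m` — preimages of `m • x`, and death of `m • y` at a finite
stage.  For `m = 1` these are the standard consequences of type `FP_∞`
([Brown1982CohomologyGroups, VIII (4.6), (4.8), VIII.4 Ex. 1]); the multiplier appears when
ascending along a subgroup of finite index ([Brown1982CohomologyGroups, III Prop. 9.5]).
[cite: Brown1982CohomologyGroups, VIII (4.6)] -/
structure IsCohFiniteTypeUpTo (k G : Type u) [CommRing k] [Group G] (m : ℕ) : Prop where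
  /-- (F): `Hⁿ(G, A)` is finitely generated for `A` finitely generated, `k` Noetherian -/
  moduleFinite : ∀ [IsNoetherianRing k] (A : Rep.{u} k G) [Module.Finite k A] (n : ℕ),
    Module.Finite k (groupCohomology A n)
  /-- (U), surjectivity half up to `m` -/
  exists_map_eq : ∀ (D : DirectedSubrepSystem k G) (n : ℕ) (x : groupCohomology D.B n),
    ∃ i, ∃ y : groupCohomology (D.A i) n, groupCohomology.map (MonoidHom.id G) (D.φ i) n y = m • x
  /-- (U), injectivity half up to `m` -/
  exists_map_eq_zero : ∀ (D : DirectedSubrepSystem k G) (n : ℕ) (i : D.ι)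
    (y : groupCohomology (D.A i) n), groupCohomology.map (MonoidHom.id G) (D.φ i) n y = 0 →
    ∃ j, ∃ h : i ≤ j, groupCohomology.map (MonoidHom.id G) (D.t h) n (m • y) = 0

namespace IsCohFiniteTypeUpTo

variable {k G : Type u} [CommRing k] [Group G] {m : ℕ}

/-- Weakening the multiplier: `m ↦ m * c`. [folklore] -/
theorem mul_right (h : IsCohFiniteTypeUpTo k G m) (c : ℕ) : IsCohFiniteTypeUpTo k G (m * c) where
  moduleFinite := h.moduleFinite
  exists_map_eq D n x := by
    obtain ⟨i, y, hy⟩ := h.exists_map_eq D n x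
    refine ⟨i, c • y, ?_⟩
    rw [map_nsmul, hy, smul_smul, mul_comm]
  exists_map_eq_zero D n i y hy := by
    obtain ⟨j, hij, hj⟩ := h.exists_map_eq_zero D n i y hy
    refine ⟨j, hij, ?_⟩
    rw [mul_comm, mul_smul, map_nsmul, hj, smul_zero]

/-- Weakening the multiplier along divisibility. [folklore] -/
theorem of_dvd {m' : ℕ} (h : IsCohFiniteTypeUpTo k G m) (hd : m ∣ m') :
    IsCohFiniteTypeUpTo k G m' := by
  obtain ⟨c, rfl⟩ := hd
  exact h.mul_right c

end IsCohFiniteTypeUpTo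

/-! ### Type `FP_∞` implies finite type (multiplier `1`) -/

section FP

variable {k G : Type u} [CommRing k] [Group G]

/-- **Groups of type `FP_∞` have cohomology of finite type**: if `k` has a projective resolution
over `k[G]` by finitely generated free modules then (F) and (U) hold with multiplier `1`
(`moduleFinite_groupCohomology_of_finiteType_resolution`,
`ResolutionComparison.exists_map_eq_of_directed`, `…_eq_zero_of_directed`).
[cite: Brown1982CohomologyGroups, VIII (4.6), VIII.4 Ex. 1]
[cite: Serre1971CohomologieGroupesDiscrets, §1.8 Remarque] -/
theorem isCohFiniteTypeUpTo_one_of_projectiveResolution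
    (P : ProjectiveResolution (Rep.trivial k G k))
    (hP : ∀ i, ∃ r : ℕ, Nonempty (P.complex.X i ≅ Rep.free k G (Fin r))) :
    IsCohFiniteTypeUpTo k G 1 where
  moduleFinite A _ n := moduleFinite_groupCohomology_of_finiteType_resolution P hP A n
  exists_map_eq D n x := by
    obtain ⟨i, y, hy⟩ := ResolutionComparison.exists_map_eq_of_directed P hP D.φ D.injective D.t
      D.t_comp D.exhaust n x
    exact ⟨i, y, by rw [hy, one_smul]⟩
  exists_map_eq_zero D n i y hy := by
    obtain ⟨j, hij, hj⟩ := ResolutionComparison.exists_map_eq_zero_of_directed P hP D.φ D.injective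
      D.t D.t_comp D.exhaust n i y hy
    exact ⟨j, hij, by rw [one_smul, hj]⟩

end FP

/-! ### Transport along a group isomorphism -/

section MulEquiv

variable {k G H : Type u} [CommRing k] [Group G] [Group H]

/-- `Hⁿ(e, 𝟙) : Hⁿ(H, A) → Hⁿ(G, Res_e A)` is Mathlib's `groupCohomology.mapIso⁻¹` for a group
isomorphism `e : G ≃* H`. [folklore] -/
theorem map_mulEquiv_eq (e : G ≃* H) (A : Rep.{u} k H) (n : ℕ) :
    groupCohomology.map (e : G →* H) (𝟙 (Rep.res (e : G →* H) A)) n =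
      (groupCohomology.mapIso (A := A) (B := Rep.res (e : G →* H) A) e (LinearEquiv.refl k _)
        (fun _ => rfl) n).inv :=
  groupCohomology.map_congr rfl rfl n

/-- `Hⁿ(e, 𝟙)` is injective for a group isomorphism `e`. [folklore] -/
theorem map_mulEquiv_injective (e : G ≃* H) (A : Rep.{u} k H) (n : ℕ) :
    Function.Injective (groupCohomology.map (e : G →* H) (𝟙 (Rep.res (e : G →* H) A)) n) := by
  rw [map_mulEquiv_eq]
  exact (groupCohomology.mapIso (A := A) (B := Rep.res (e : G →* H) A) e (LinearEquiv.refl k _)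
    (fun _ => rfl) n).toLinearEquiv.symm.injective

/-- `Hⁿ(e, 𝟙)` is surjective for a group isomorphism `e`. [folklore] -/
theorem map_mulEquiv_surjective (e : G ≃* H) (A : Rep.{u} k H) (n : ℕ) :
    Function.Surjective (groupCohomology.map (e : G →* H) (𝟙 (Rep.res (e : G →* H) A)) n) := by
  rw [map_mulEquiv_eq]
  exact (groupCohomology.mapIso (A := A) (B := Rep.res (e : G →* H) A) e (LinearEquiv.refl k _)
    (fun _ => rfl) n).toLinearEquiv.symm.surjective

/-- Naturality of `Hⁿ(f, 𝟙)` in the coefficients (Mathlib `groupCohomology.resNatTrans`),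
element form. [folklore] -/
theorem map_res_naturality_apply (f : G →* H) {A B : Rep.{u} k H} (φ : A ⟶ B) (n : ℕ)
    (x : groupCohomology A n) :
    groupCohomology.map f (𝟙 (Rep.res f B)) n (groupCohomology.map (MonoidHom.id H) φ n x) =
      groupCohomology.map (MonoidHom.id G) ((Rep.resFunctor f).map φ) n
        (groupCohomology.map f (𝟙 (Rep.res f A)) n x) := by
  have h := (groupCohomology.resNatTrans k f n).naturality φ
  have h' := congrArg (fun F => (ModuleCat.Hom.hom F) x) h
  simp only [Functor.comp_map, groupCohomology.functor_map, groupCohomology.resNatTrans_app] at h'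
  exact h'

/-- **Transport along a group isomorphism**: `IsCohFiniteTypeUpTo` is invariant under `G ≃* H`.
[folklore] -/
theorem IsCohFiniteTypeUpTo.of_mulEquiv {m : ℕ} (e : G ≃* H) (hG : IsCohFiniteTypeUpTo k G m) :
    IsCohFiniteTypeUpTo k H m where
  moduleFinite A _ n := moduleFinite_groupCohomology_of_mulEquiv e (fun B hB n => by
    haveI := hB; exact hG.moduleFinite B n) A n
  exists_map_eq D n x := by
    obtain ⟨i, y', hy'⟩ := hG.exists_map_eq (D.res (e : G →* H)) n
      (groupCohomology.map (e : G →* H) (𝟙 (Rep.res (e : G →* H) D.B)) n x)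
    change groupCohomology.map (MonoidHom.id G) ((Rep.resFunctor (e : G →* H)).map (D.φ i)) n y' =
      m • groupCohomology.map (e : G →* H) (𝟙 (Rep.res (e : G →* H) D.B)) n x at hy'
    obtain ⟨y, hy⟩ := map_mulEquiv_surjective e (D.A i) n y'
    refine ⟨i, y, map_mulEquiv_injective e D.B n ?_⟩
    rw [map_res_naturality_apply, hy, map_nsmul]
    exact hy'
  exists_map_eq_zero D n i y hy := by
    have hy' : groupCohomology.map (MonoidHom.id G) (A := Rep.res (e : G →* H) (D.A i))
        (B := Rep.res (e : G →* H) D.B) ((Rep.resFunctor (e : G →* H)).map (D.φ i)) n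
        (groupCohomology.map (e : G →* H) (𝟙 (Rep.res (e : G →* H) (D.A i))) n y) = 0 := by
      rw [← map_res_naturality_apply, hy, map_zero]
    obtain ⟨j, hij, hj⟩ := hG.exists_map_eq_zero (D.res (e : G →* H)) n i _ hy'
    change groupCohomology.map (MonoidHom.id G) (A := Rep.res (e : G →* H) (D.A i))
      (B := Rep.res (e : G →* H) (D.A j)) ((Rep.resFunctor (e : G →* H)).map (D.t hij)) n
      (m • groupCohomology.map (e : G →* H) (𝟙 (Rep.res (e : G →* H) (D.A i))) n y) = 0 at hj
    refine ⟨j, hij, map_mulEquiv_injective e (D.A j) n ?_⟩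
    rw [map_zero, map_nsmul, map_nsmul, map_res_naturality_apply, ← map_nsmul]
    exact hj

end MulEquiv

/-! ### Descent to a subgroup of finite index -/

section Descent

variable {k G : Type u} [CommRing k] [Group G] (S : Subgroup G) [S.FiniteIndex]

/-- **Descent to a subgroup of finite index** (Shapiro `Hⁿ(S, A) ≅ Hⁿ(G, Coind_S^G A)`, natural in
`A`, and `Coind` of a directed union from a subgroup of finite index is a directed union).
[cite: Brown1982CohomologyGroups, III (6.2)] -/
theorem IsCohFiniteTypeUpTo.subgroup {m : ℕ} (hG : IsCohFiniteTypeUpTo k G m) :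
    IsCohFiniteTypeUpTo k S m where
  moduleFinite A _ n := moduleFinite_groupCohomology_subgroup_of_finiteIndex S
    (fun B hB n => by haveI := hB; exact hG.moduleFinite B n) A n
  exists_map_eq D n x := by
    obtain ⟨i, y', hy'⟩ := hG.exists_map_eq (D.coind S) n ((groupCohomology.coindIso D.B n).inv x)
    change groupCohomology.map (MonoidHom.id G) (Rep.coindMap S.subtype (D.φ i)) n y' =
      m • (groupCohomology.coindIso D.B n).inv x at hy'
    refine ⟨i, (groupCohomology.coindIso (D.A i) n).hom y', ?_⟩
    rw [← coindIso_hom_naturality_apply, hy', map_nsmul, iso_hom_inv_apply]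
  exists_map_eq_zero D n i y hy := by
    let y' : groupCohomology (Rep.coind S.subtype (D.A i)) n :=
      (groupCohomology.coindIso (D.A i) n).inv y
    have hy' : groupCohomology.map (MonoidHom.id G) (Rep.coindMap S.subtype (D.φ i)) n y' = 0 := by
      change groupCohomology.map (MonoidHom.id G) (Rep.coindMap S.subtype (D.φ i)) n
        ((groupCohomology.coindIso (D.A i) n).inv y) = 0
      rw [← coindIso_inv_naturality_apply, hy, map_zero]
    obtain ⟨j, hij, hj⟩ := hG.exists_map_eq_zero (D.coind S) n i y' hy'
    change groupCohomology.map (MonoidHom.id G) (Rep.coindMap S.subtype (D.t hij)) n (m • y') = 0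
      at hj
    refine ⟨j, hij, ?_⟩
    have h : y = (groupCohomology.coindIso (D.A i) n).hom y' := (iso_hom_inv_apply _ y).symm
    rw [h, ← map_nsmul, ← coindIso_hom_naturality_apply, hj, map_zero]

end Descent

/-! ### Ascent from a subgroup of finite index -/

section Ascent

variable {k G : Type u} [CommRing k] [Group G] (S : Subgroup G)

/-- Naturality of the unit `η : A ⟶ Coind_S^G Res_S A` in `A`. [folklore] -/
theorem coindUnit_naturality {A B : Rep.{u} k G} (f : A ⟶ B) :
    f ≫ coindUnit S B = coindUnit S A ≫ Rep.coindMap S.subtype ((Rep.resFunctor S.subtype).map f) := by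
  refine Rep.hom_ext (Representation.IntertwiningMap.ext (LinearMap.ext fun a => ?_))
  apply Subtype.ext
  funext x
  change (((coindUnit S B).hom (f.hom a) : Rep.coind S.subtype (Rep.res S.subtype B)) : G → B) x =
    ((Rep.coindMap S.subtype ((Rep.resFunctor S.subtype).map f)).hom ((coindUnit S A).hom a) :
      G → B) x
  rw [coindUnit_hom_apply_coe]
  simp only [Rep.coindMap, Rep.hom_ofHom, Representation.coindMap_coe_apply_apply]
  change (B.ρ x) (f.hom a) = f.hom (((coindUnit S A).hom a : G → A) x)
  rw [coindUnit_hom_apply_coe, Rep.hom_comm_apply]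

/-- Element form of `coindUnit_naturality` on cohomology. [folklore] -/
theorem map_coindUnit_map_apply {A B : Rep.{u} k G} (f : A ⟶ B) (n : ℕ) (x : groupCohomology A n) :
    groupCohomology.map (MonoidHom.id G) (coindUnit S B) n (groupCohomology.map (MonoidHom.id G) f n x) =
      groupCohomology.map (MonoidHom.id G) (Rep.coindMap S.subtype ((Rep.resFunctor S.subtype).map f)) n
        (groupCohomology.map (MonoidHom.id G) (coindUnit S A) n x) := by
  have h := congrArg (fun F => (groupCohomology.map (MonoidHom.id G) F n : groupCohomology A n ⟶ _) x)
    (coindUnit_naturality S f)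
  simp only [groupCohomology.map_id_comp, ModuleCat.comp_apply] at h
  exact h

variable [S.FiniteIndex]

/-- Naturality of the trace `τ : Coind_S^G Res_S A ⟶ A` in `A`. [folklore] -/
theorem coindTrace_naturality {A B : Rep.{u} k G} (f : A ⟶ B) :
    Rep.coindMap S.subtype ((Rep.resFunctor S.subtype).map f) ≫ coindTrace S B = coindTrace S A ≫ f := by
  classical
  refine Rep.hom_ext (Representation.IntertwiningMap.ext (LinearMap.ext fun F => ?_))
  change (coindTrace S B).hom ((Rep.coindMap S.subtype ((Rep.resFunctor S.subtype).map f)).hom F) =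
    f.hom ((coindTrace S A).hom F)
  rw [coindTrace_hom_apply, coindTrace_hom_apply, map_sum]
  refine Finset.sum_congr rfl fun c _ => ?_
  induction c using QuotientGroup.induction_on with
  | H y =>
    rw [traceTerm_mk, traceTerm_mk, Rep.hom_comm_apply]
    rfl

/-- Element form of `coindTrace_naturality` on cohomology. [folklore] -/
theorem map_coindTrace_map_apply {A B : Rep.{u} k G} (f : A ⟶ B) (n : ℕ)
    (x : groupCohomology (Rep.coind S.subtype (Rep.res S.subtype A)) n) :
    groupCohomology.map (MonoidHom.id G) (coindTrace S B) n
        (groupCohomology.map (MonoidHom.id G)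
          (Rep.coindMap S.subtype ((Rep.resFunctor S.subtype).map f)) n x) =
      groupCohomology.map (MonoidHom.id G) f n
        (groupCohomology.map (MonoidHom.id G) (coindTrace S A) n x) := by
  have h := congrArg (fun F => (groupCohomology.map (MonoidHom.id G) F n :
    groupCohomology (Rep.coind S.subtype (Rep.res S.subtype A)) n ⟶ _) x) (coindTrace_naturality S f)
  simp only [groupCohomology.map_id_comp, ModuleCat.comp_apply] at h
  exact h

/-- `Hⁿ(τ) (Hⁿ(η) x) = [G : S] • x`, coercion form of `trace_comp_unit_apply`. [folklore] -/
theorem map_coindTrace_map_coindUnit_apply (A : Rep.{u} k G) (n : ℕ) (x : groupCohomology A n) :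
    groupCohomology.map (MonoidHom.id G) (coindTrace S A) n
        (groupCohomology.map (MonoidHom.id G) (coindUnit S A) n x) = S.index • x :=
  trace_comp_unit_apply S A n x

/-- **Ascent from a subgroup of finite index**: if `Hⁿ(S, -)` is of finite type up to `m` and
`[G : S] = d`, then `Hⁿ(G, -)` is of finite type up to `m * d` (unit and trace,
`η ≫ τ = [G : S] • 𝟙`, and the natural Shapiro isomorphism; (F) ascends by dimension shifting,
`moduleFinite_groupCohomology_of_finiteIndex`). [cite: Brown1982CohomologyGroups, III Prop. 9.5]
[cite: Brown1982CohomologyGroups, VIII (5.1)] -/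
theorem IsCohFiniteTypeUpTo.of_subgroup {m : ℕ} (hS : IsCohFiniteTypeUpTo k S m) :
    IsCohFiniteTypeUpTo k G (m * S.index) where
  moduleFinite A hA n := moduleFinite_groupCohomology_of_finiteIndex S
      (fun B hB n => by haveI := hB; exact hS.moduleFinite B n) n A hA
  exists_map_eq D n x := by
    -- `η_* x`, moved to `Hⁿ(S, Res B)` by Shapiro
    let eB := groupCohomology.coindIso (Rep.res S.subtype D.B) n
    let z : groupCohomology (Rep.res S.subtype D.B) n :=
      eB.hom (groupCohomology.map (MonoidHom.id G) (coindUnit S D.B) n x)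
    obtain ⟨i, yS, hyS⟩ := hS.exists_map_eq (D.res S.subtype) n z
    change groupCohomology.map (MonoidHom.id S) ((Rep.resFunctor S.subtype).map (D.φ i)) n yS =
      m • z at hyS
    let eA := groupCohomology.coindIso (Rep.res S.subtype (D.A i)) n
    let yG : groupCohomology (Rep.coind S.subtype (Rep.res S.subtype (D.A i))) n := eA.inv yS
    have hyG : groupCohomology.map (MonoidHom.id G)
        (Rep.coindMap S.subtype ((Rep.resFunctor S.subtype).map (D.φ i))) n yG =
        m • groupCohomology.map (MonoidHom.id G) (coindUnit S D.B) n x := by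
      change groupCohomology.map (MonoidHom.id G)
        (Rep.coindMap S.subtype ((Rep.resFunctor S.subtype).map (D.φ i))) n (eA.inv yS) = _
      rw [← coindIso_inv_naturality_apply, hyS, map_nsmul]
      change m • eB.inv (eB.hom _) = _
      rw [iso_inv_hom_apply]
    refine ⟨i, groupCohomology.map (MonoidHom.id G) (coindTrace S (D.A i)) n yG, ?_⟩
    rw [← map_coindTrace_map_apply, hyG, map_nsmul, map_coindTrace_map_coindUnit_apply, smul_smul]
  exists_map_eq_zero D n i y hy := by
    let eA := groupCohomology.coindIso (Rep.res S.subtype (D.A i)) n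
    let zS : groupCohomology (Rep.res S.subtype (D.A i)) n :=
      eA.hom (groupCohomology.map (MonoidHom.id G) (coindUnit S (D.A i)) n y)
    have hzS : groupCohomology.map (MonoidHom.id S) ((D.res S.subtype).φ i) n zS = 0 := by
      change groupCohomology.map (MonoidHom.id S) ((Rep.resFunctor S.subtype).map (D.φ i)) n
        (eA.hom (groupCohomology.map (MonoidHom.id G) (coindUnit S (D.A i)) n y)) = 0
      rw [← coindIso_hom_naturality_apply, ← map_coindUnit_map_apply, hy, map_zero, map_zero]
    obtain ⟨j, hij, hj⟩ := hS.exists_map_eq_zero (D.res S.subtype) n i zS hzS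
    change groupCohomology.map (MonoidHom.id S) ((Rep.resFunctor S.subtype).map (D.t hij)) n
      (m • zS) = 0 at hj
    refine ⟨j, hij, ?_⟩
    -- `η_* (t_* (m • y)) = 0` in `Hⁿ(G, Coind Res A_j)`
    have hη : groupCohomology.map (MonoidHom.id G) (coindUnit S (D.A j)) n
        (groupCohomology.map (MonoidHom.id G) (D.t hij) n (m • y)) = 0 := by
      rw [map_coindUnit_map_apply, map_nsmul]
      apply (groupCohomology.coindIso (Rep.res S.subtype (D.A j)) n).toLinearEquiv.injective
      change (groupCohomology.coindIso (Rep.res S.subtype (D.A j)) n).hom _ =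
        (groupCohomology.coindIso (Rep.res S.subtype (D.A j)) n).hom 0
      rw [coindIso_hom_naturality_apply, map_nsmul, map_zero]
      exact hj
    have htr := map_coindTrace_map_coindUnit_apply S (D.A j) n
      (groupCohomology.map (MonoidHom.id G) (D.t hij) n (m • y))
    rw [hη, map_zero] at htr
    rw [mul_comm, mul_smul, map_nsmul]
    exact htr.symm

end Ascent

/-! ### Commensurable subgroups -/

section Commensurable

variable {k G : Type u} [CommRing k] [Group G]

/-- **Commensurable subgroups**: if `Γ₀, Γ ≤ G` are commensurable and `Hⁿ(Γ₀, -)` is of finite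
type up to `m`, then `Hⁿ(Γ, -)` is of finite type up to `m * [Γ : Γ ∩ Γ₀]` (descend to `Γ ∩ Γ₀`,
transport along `(Γ ∩ Γ₀ ≤ Γ₀) ≃* (Γ ∩ Γ₀ ≤ Γ)`, ascend).
[cite: Brown1982CohomologyGroups, VIII (5.1)] [cite: Serre1971CohomologieGroupesDiscrets, §1.8] -/
theorem IsCohFiniteTypeUpTo.of_commensurable {m : ℕ} (Γ₀ Γ : Subgroup G)
    [(Γ.subgroupOf Γ₀).FiniteIndex] [(Γ₀.subgroupOf Γ).FiniteIndex]
    (h₀ : IsCohFiniteTypeUpTo k Γ₀ m) :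
    IsCohFiniteTypeUpTo k Γ (m * (Γ₀.subgroupOf Γ).index) := by
  haveI : ((Γ ⊓ Γ₀).subgroupOf Γ₀).FiniteIndex := by
    rw [Subgroup.inf_subgroupOf_right]
    infer_instance
  haveI h2 : ((Γ ⊓ Γ₀).subgroupOf Γ).FiniteIndex := by
    rw [Subgroup.inf_subgroupOf_left]
    infer_instance
  have h₁ : IsCohFiniteTypeUpTo k ((Γ ⊓ Γ₀).subgroupOf Γ₀) m := h₀.subgroup _
  let e : (Γ ⊓ Γ₀).subgroupOf Γ₀ ≃* (Γ ⊓ Γ₀).subgroupOf Γ :=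
    (Subgroup.subgroupOfEquivOfLe inf_le_right).trans (Subgroup.subgroupOfEquivOfLe inf_le_left).symm
  have h₂ : IsCohFiniteTypeUpTo k ((Γ ⊓ Γ₀).subgroupOf Γ) m := h₁.of_mulEquiv e
  have h₃ := h₂.of_subgroup
  have hidx : ((Γ ⊓ Γ₀).subgroupOf Γ).index = (Γ₀.subgroupOf Γ).index := by
    rw [Subgroup.inf_subgroupOf_left]
  rw [hidx] at h₃
  exact h₃

end Commensurable

end Literature.Algebra.Homology
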